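import Mathlib
import Literature.Computability.Complexity.CliqueTestGraphs
import Literature.Computability.Complexity.MatchingExtensionComplexity
import Summits.PneNP.PneNP.Theorems.ConvexRankGatesConvexGateBlindExponentDown
import Summits.PneNP.PneNP.Theorems.ConvexRankGatesConvexGateBlindMatchingMinor

/-!
# Crux `ConvexGateBlind` (stmt-PneNP-10680), line `strict-rank-conic-cover`:
# the LP slice of `stub_unitPotentialHard` from Rothvoss's matching theorem

`stub_unitPotentialHard` of the line asserts that the unit-potential (`ε = 1`, Karchmer–Wigderson slack) matrix
`D_{m,⌈√m⌉} − J` of `CLIQUE(m, ⌈√m⌉)` has superpolynomial `(PSD_q × ℝ^r_{≥0})`-cone rank. Its LP slice `q = 0`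
(non-negative rank) is IN PRINT modulo transport, and the transport is elementary: by
`ConvexRankGatesConvexGateBlindMatchingMinor` (perfect matching = read-once monotone projection of clique, plus the
line's apex padding) `D_{m, h+1+p} − J` contains Rothvoss's odd-cut slack matrix of the perfect matching polytope of
`K_{2h}` whenever `C(2h,2) + 1 + p ≤ m`; with `k = ⌈√m⌉₊`, `h = ⌊(k-2)/2⌋`, `p = k - h - 1` this fits for all large
`m` (`eventually_matching_fits`) with `2h ≥ √m - 3`, and Rothvoss's bound `rk₊ > 2^{c₀ n}` (NAMED FACT
`Literature.Computability.Complexity.rothvoss_matching_slack_bound`, Rothvoss 2017 Thm 1 in slack form) beats every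
`m^c` (`eventually_pow_le_two_rpow`: `log m = o(√m)`). Result: `stub_unitPotentialHard_lp` (registered helper stub,
CONDITIONAL on the named fact): `∀ c, ∀ᶠ m, ∀ r ≤ m^c, ¬ ConeFactorisable m ⌈√m⌉₊ 0 r 1 1`. What remains open in
`stub_unitPotentialHard` is exactly its PSD part (`q > 0`). [folklore] numerics; [cite: Rothvoss2017, Thm. 1] for the
bound (taken as hypothesis, not restated).
-/

namespace Summit.PneNP.PneNP.Cruxes.ConvexGateBlind.StrictRankConicCover

open Matrix Finset Filter Literature.Computability.Complexity

noncomputable section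

/-- Numerics of the padding: eventually `k = ⌈√m⌉₊ ≥ 8` and, with `h = ⌊(k-2)/2⌋`, the host graph on
`C(2h,2) + 1` vertices plus `k - (h+1)` apexes fits into `m` vertices. [folklore] -/
theorem eventually_matching_fits :
    ∀ᶠ m : ℕ in atTop, 8 ≤ ⌈(m : ℝ) ^ (1 / 2 : ℝ)⌉₊ ∧
      (2 * ((⌈(m : ℝ) ^ (1 / 2 : ℝ)⌉₊ - 2) / 2)).choose 2 + 1 +
        (⌈(m : ℝ) ^ (1 / 2 : ℝ)⌉₊ - ((⌈(m : ℝ) ^ (1 / 2 : ℝ)⌉₊ - 2) / 2 + 1)) ≤ m := by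
  have hsqrt : Tendsto (fun m : ℕ => (m : ℝ) ^ (1 / 2 : ℝ)) atTop atTop :=
    (tendsto_rpow_atTop (by norm_num)).comp tendsto_natCast_atTop_atTop
  have hceil : Tendsto (fun m : ℕ => ⌈(m : ℝ) ^ (1 / 2 : ℝ)⌉₊) atTop atTop := tendsto_nat_ceil_atTop.comp hsqrt
  filter_upwards [hceil.eventually_ge_atTop 8, eventually_ge_atTop 1] with m hk8 hm1
  refine ⟨hk8, ?_⟩
  set k : ℕ := ⌈(m : ℝ) ^ (1 / 2 : ℝ)⌉₊ with hk
  set h : ℕ := (k - 2) / 2 with hh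
  have hm0 : (0 : ℝ) ≤ m := Nat.cast_nonneg m
  have hx0 : (0 : ℝ) ≤ (m : ℝ) ^ (1 / 2 : ℝ) := by positivity
  have hsq : ((m : ℝ) ^ (1 / 2 : ℝ)) ^ 2 = m := by
    rw [← Real.rpow_natCast, ← Real.rpow_mul hm0]; norm_num
  have hklt : (k : ℝ) < (m : ℝ) ^ (1 / 2 : ℝ) + 1 := Nat.ceil_lt_add_one hx0
  have hkge : (m : ℝ) ^ (1 / 2 : ℝ) ≤ k := Nat.le_ceil _
  -- `C(2h,2) ≤ (2h)^2 ≤ (k-2)^2`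
  have h2h : 2 * h ≤ k - 2 := by omega
  have hNE : (2 * h).choose 2 ≤ (k - 2) ^ 2 :=
    (Nat.choose_le_pow _ _).trans (Nat.pow_le_pow_left h2h 2)
  -- it suffices that `(k-2)^2 + 1 + k ≤ m`, which holds as `k < √m + 1`
  have hk2 : (((k - 2 : ℕ) : ℝ)) = (k : ℝ) - 2 := by
    rw [Nat.cast_sub (by omega)]; norm_num
  have hreal : (((k - 2) ^ 2 + 1 + k : ℕ) : ℝ) ≤ m := by
    push_cast [Nat.cast_sub (show 2 ≤ k by omega)]
    have h7 : (7 : ℝ) ≤ (m : ℝ) ^ (1 / 2 : ℝ) := by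
      have : (8 : ℝ) ≤ k := by exact_mod_cast hk8
      linarith
    nlinarith [hsq, hklt, hkge, h7]
  have hnat : (k - 2) ^ 2 + 1 + k ≤ m := by exact_mod_cast hreal
  omega

/-- Numerics of the size budget: eventually `m ^ c ≤ 2 ^ (c₀ · 2h)` for `h = ⌊(⌈√m⌉₊ - 2)/2⌋` (`2h ≥ √m - 3` and
`log m = o(√m)`). [folklore] -/
theorem eventually_pow_le_two_rpow (c : ℕ) {c₀ : ℝ} (hc₀ : 0 < c₀) :
    ∀ᶠ m : ℕ in atTop, ((m ^ c : ℕ) : ℝ) ≤ (2 : ℝ) ^ (c₀ * ((2 * ((⌈(m : ℝ) ^ (1 / 2 : ℝ)⌉₊ - 2) / 2) : ℕ) : ℝ)) := by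
  have hsqrt : Tendsto (fun m : ℕ => (m : ℝ) ^ (1 / 2 : ℝ)) atTop atTop :=
    (tendsto_rpow_atTop (by norm_num)).comp tendsto_natCast_atTop_atTop
  -- `log m ≤ ε √m` eventually, `ε = c₀ log 2 / (2 (c + 1))`
  set ε : ℝ := c₀ * Real.log 2 / (2 * (c + 1)) with hε
  have hlog2 : 0 < Real.log 2 := Real.log_pos (by norm_num)
  have hc1 : (0 : ℝ) < c + 1 := by positivity
  have hεpos : 0 < ε := by positivity
  have hlo := (isLittleO_log_rpow_atTop (by norm_num : (0 : ℝ) < 1 / 2)).bound hεpos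
  have hlo' : ∀ᶠ m : ℕ in atTop, ‖Real.log m‖ ≤ ε * ‖(m : ℝ) ^ (1 / 2 : ℝ)‖ :=
    tendsto_natCast_atTop_atTop.eventually hlo
  filter_upwards [hlo', hsqrt.eventually_ge_atTop 6, eventually_ge_atTop 1] with m hlog hx6 hm1
  set k : ℕ := ⌈(m : ℝ) ^ (1 / 2 : ℝ)⌉₊ with hk
  set h : ℕ := (k - 2) / 2 with hh
  have hmpos : (0 : ℝ) < m := by exact_mod_cast hm1
  have hx0 : (0 : ℝ) ≤ (m : ℝ) ^ (1 / 2 : ℝ) := by positivity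
  have hkge : (m : ℝ) ^ (1 / 2 : ℝ) ≤ k := Nat.le_ceil _
  -- `√m - 3 ≤ 2h`
  have h2h : k ≤ 2 * h + 3 := by omega
  have h2hr : (m : ℝ) ^ (1 / 2 : ℝ) - 3 ≤ ((2 * h : ℕ) : ℝ) := by
    have : (k : ℝ) ≤ ((2 * h : ℕ) : ℝ) + 3 := by exact_mod_cast h2h
    linarith
  -- `c log m ≤ c₀ log 2 (√m - 3)`
  have hlogm : Real.log m ≤ ε * (m : ℝ) ^ (1 / 2 : ℝ) := by
    have h1 : Real.log m ≤ ‖Real.log m‖ := Real.le_norm_self _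
    rw [Real.norm_of_nonneg hx0] at hlog
    exact h1.trans hlog
  have hmain : (c : ℝ) * Real.log m ≤ Real.log 2 * (c₀ * ((2 * h : ℕ) : ℝ)) := by
    have hc0 : (0 : ℝ) ≤ c := Nat.cast_nonneg c
    have step1 : (c : ℝ) * Real.log m ≤ c * (ε * (m : ℝ) ^ (1 / 2 : ℝ)) := mul_le_mul_of_nonneg_left hlogm hc0
    have step2 : (c : ℝ) * ε ≤ c₀ * Real.log 2 / 2 := by
      rw [hε]
      rw [show (c : ℝ) * (c₀ * Real.log 2 / (2 * (c + 1))) = c₀ * Real.log 2 / 2 * (c / (c + 1)) by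
        field_simp]
      have : (c : ℝ) / (c + 1) ≤ 1 := (div_le_one hc1).2 (by linarith)
      have hpos : 0 ≤ c₀ * Real.log 2 / 2 := by positivity
      nlinarith
    have step3 : c₀ * Real.log 2 / 2 * (m : ℝ) ^ (1 / 2 : ℝ) ≤ Real.log 2 * (c₀ * ((2 * h : ℕ) : ℝ)) := by
      have : (m : ℝ) ^ (1 / 2 : ℝ) / 2 ≤ (m : ℝ) ^ (1 / 2 : ℝ) - 3 := by linarith
      have hpos : 0 ≤ c₀ * Real.log 2 := by positivity
      nlinarith [h2hr]
    calc (c : ℝ) * Real.log m ≤ c * (ε * (m : ℝ) ^ (1 / 2 : ℝ)) := step1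
      _ = (c * ε) * (m : ℝ) ^ (1 / 2 : ℝ) := by ring
      _ ≤ c₀ * Real.log 2 / 2 * (m : ℝ) ^ (1 / 2 : ℝ) := mul_le_mul_of_nonneg_right step2 hx0
      _ ≤ Real.log 2 * (c₀ * ((2 * h : ℕ) : ℝ)) := step3
  -- exponentiate
  have hl : ((m ^ c : ℕ) : ℝ) = Real.exp ((c : ℝ) * Real.log m) := by
    rw [Nat.cast_pow, ← Real.rpow_natCast, Real.rpow_def_of_pos hmpos, mul_comm]
  have hr : (2 : ℝ) ^ (c₀ * ((2 * h : ℕ) : ℝ)) = Real.exp (Real.log 2 * (c₀ * ((2 * h : ℕ) : ℝ))) :=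
    Real.rpow_def_of_pos (by norm_num) _
  rw [hl, hr, Real.exp_le_exp]
  exact hmain

/-- **The LP slice of `stub_unitPotentialHard` from Rothvoss's theorem.** Assuming Rothvoss's exponential lower bound
for the non-negative rank of the odd-cut slack matrix of the perfect matching polytope
(`Literature.Computability.Complexity.rothvoss_matching_slack_bound`, Rothvoss 2017 Thm 1), the unit-potential
matrix `D_{m,⌈√m⌉} − J` of `CLIQUE(m, ⌈√m⌉)` has no `(PSD_0 × ℝ^r_{≥0})`-factorisation with `r ≤ m^c`, for every `c`
and all large `m`: PERFECT-MATCHING is a read-once monotone projection of CLIQUE (hub + disjointness graph on the edges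
of `K_n`), so Rothvoss's matrix is a submatrix of `D − J` (`matchingSlack_of_coneFactorisable_pad`), of exponential
non-negative rank in `n ≈ √m`. (The `q > 0` part of the stub — PSD factors — is untouched.) [folklore] -/
theorem stub_unitPotentialHard_lp :
    Literature.Computability.Complexity.rothvoss_matching_slack_bound →
      ∀ c : ℕ, ∀ᶠ m : ℕ in atTop, ∀ r : ℕ, r ≤ m ^ c →
        ¬ ConeFactorisable m ⌈(m : ℝ) ^ (1 / 2 : ℝ)⌉₊ 0 r (fun _ => 1) (fun _ => 1) := by
  rintro ⟨c₀, hc₀, hev⟩ c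
  have hsqrt : Tendsto (fun m : ℕ => (m : ℝ) ^ (1 / 2 : ℝ)) atTop atTop :=
    (tendsto_rpow_atTop (by norm_num)).comp tendsto_natCast_atTop_atTop
  have hceil : Tendsto (fun m : ℕ => ⌈(m : ℝ) ^ (1 / 2 : ℝ)⌉₊) atTop atTop := tendsto_nat_ceil_atTop.comp hsqrt
  have hn : Tendsto (fun m : ℕ => 2 * ((⌈(m : ℝ) ^ (1 / 2 : ℝ)⌉₊ - 2) / 2)) atTop atTop := by
    refine tendsto_atTop_mono (fun m => ?_) ((tendsto_sub_atTop_nat 3).comp hceil)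
    simp only [Function.comp_apply]
    omega
  filter_upwards [hn.eventually hev, eventually_matching_fits, eventually_pow_le_two_rpow c hc₀]
    with m hR hfit hpow
  obtain ⟨hk8, hfit⟩ := hfit
  intro r hr hf
  set k : ℕ := ⌈(m : ℝ) ^ (1 / 2 : ℝ)⌉₊ with hk
  set h : ℕ := (k - 2) / 2 with hh
  have hh1 : 1 ≤ h := by omega
  have hkeq : k = h + 1 + (k - (h + 1)) := by omega
  rw [hkeq] at hf
  obtain ⟨a, b, ha, hb, hfac⟩ := matchingSlack_of_coneFactorisable_pad hh1 hfit hf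
  have hrle : (r : ℝ) ≤ (2 : ℝ) ^ (c₀ * ((2 * h : ℕ) : ℝ)) :=
    le_trans (by exact_mod_cast hr) hpow
  exact hR (even_two_mul h) r hrle a b ha hb hfac

end

end Summit.PneNP.PneNP.Cruxes.ConvexGateBlind.StrictRankConicCover
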